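import Summits.QuantumFields.YangMills.Theorems.BalabanLadderNTSubsequentialCompactFamily
import Summits.QuantumFields.YangMills.Theorems.BalabanLadderNTReferenceMarginsExplicit
import Summits.QuantumFields.YangMills.Theorems.SqueezedSkewnessMirrorDescentModulus
import Summits.QuantumFields.YangMills.Theorems.BalabanLadderUVSeamRecUnitDilation
import HarnessLib

/-!
# Crux `NT` (stmt-QuantumFields-19353): lattice bookkeeping for the dilation family of NT's witnesses —
# torus separation from physical distance, `ℓ¹` sums of dilates, the trilinear difference bound for `Q3`

Helper file (`--supports stmt-QuantumFields-19353`) of the fleet lead prover of crux `NT` (unit `ym-spine-19353-p1`, g29),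
hypothesis-free; sequel of `…NTSubsequentialCompactFamily` (§1 there: compact witness families reduce to one witness given a
Lipschitz modulus).  Here the modulus is SUPPLIED for the dilation family `v_μ = v ∘ (μ •)` of compactly supported witnesses,
at ONE coupling on ONE odd torus, from the `n`-point collar bound of `MomentBounds` (constant `C`, radius `R`) — the same input as
g23's `MirrorDescentModulus.modulus_bound` (shift family) —:

* §1 geometry: `exists_norm_le_two_mul_abs_apply` (in `E⁴` some coordinate carries half the norm), **`torusSep_of_dist`**
  (two charged lattice points at physical distance `≥ δ`, both within radius `σ'`, `2σ' ≤ sL`, `4(R+2)s ≤ δ`, are `2R+4`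
  torus-separated in some coordinate);
* §2 lattice `ℓ¹` sums of dilates and of their differences (`sum_abs_dilate_le`, `sum_abs_dilate_sub_le` and the reflected
  versions): `Σ_x |v(μ s x)| ≤ M (2σ+3)⁴/(μ s)⁴`, `Σ_x |v(μ s x) − v(ν s x)| ≤ Lip (σ/m₁) |μ−ν| (2σ/m₁ + 3)⁴ / s⁴`;
* §3 `abs_Q3_sub_Q3_le` — the trilinear analogue of g23's `abs_Q2_sub_Q2_le` (pointwise bound on charged triples);
(The modulus itself — `abs_Q2_dilate_sub_le`, `abs_Q3_dilate_sub_le` under the collar bound — is the sequel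
`…NTSubsequentialUnitModulus`.)

HONEST FRAMING: finite-torus bookkeeping at one coupling; the collar bound is a HYPOTHESIS (it is the UV leg `MomentBounds`);
nothing about `NT`, floors, the gap, or Clay. [folklore]
-/

set_option autoImplicit false

noncomputable section

open scoped SchwartzMap
open MeasureTheory Filter Topology Finset
open Literature.MathematicalPhysics.QuantumFieldTheory Literature.MathematicalPhysics.QuantumLattice
open Literature.Probability.LatticeModels
open Summit.QuantumFields.YangMills.Cruxes.OSLegsFromFemtoAndGap.DlrCollarTransfer
open Summit.QuantumFields.YangMills.Cruxes.NT.Reference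
  (sum_abs_lattice_le_sup_div tsupport_thetaTest_subset_closedBall_zero smul_siteToE_apply_zero)
open Summit.QuantumFields.YangMills.Theorems.MirrorDescentModulus (abs_Q2_sub_Q2_le abs_torusCov_le_two torusSep_of_gap)
open Summit.QuantumFields.YangMills.Cruxes.UVSeamRec.UnitDilation (compCLM_apply_smul thetaTest_compCLM_apply tsupport_compCLM)

namespace Summit.QuantumFields.YangMills.Cruxes.NT.Subsequential

/-! ## §1 Geometry: torus separation from physical distance -/

/-- In `E⁴` some coordinate carries at least half of the norm: `‖z‖ ≤ 2 |z k|` for some `k`. [folklore] -/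
theorem exists_norm_le_two_mul_abs_apply (z : EuclideanSpace ℝ (Fin 4)) : ∃ k : Fin 4, ‖z‖ ≤ 2 * |z k| := by
  obtain ⟨k, -, hk⟩ := Finset.exists_max_image (Finset.univ : Finset (Fin 4)) (fun i => |z i|) Finset.univ_nonempty
  refine ⟨k, ?_⟩
  have hsq : ‖z‖ ^ 2 ≤ (2 * |z k|) ^ 2 := by
    rw [EuclideanSpace.norm_sq_eq]
    calc ∑ i, ‖z i‖ ^ 2 ≤ ∑ _i : Fin 4, |z k| ^ 2 := Finset.sum_le_sum fun i _ => by
            rw [Real.norm_eq_abs]; exact pow_le_pow_left₀ (abs_nonneg _) (hk i (Finset.mem_univ _)) 2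
      _ = (2 * |z k|) ^ 2 := by
            rw [Finset.sum_const, Finset.card_univ, Fintype.card_fin, nsmul_eq_mul]; push_cast; ring
  exact le_of_sq_le_sq hsq (by positivity)

/-- **Torus separation from physical distance.**  On the torus of side `2L+1` at spacing `s > 0`: two lattice points whose
smeared positions are at physical distance `≥ δ`, both within radius `σ'` of the origin, `2σ' ≤ sL` (no wrap-around) and
`4(R+2)s ≤ δ`, are `2R+4` apart in some coordinate, cyclically. [folklore] -/
theorem torusSep_of_dist {s δ σ' : ℝ} (hs : 0 < s) {L R : ℕ} (hσL : 2 * σ' ≤ s * L) (hRδ : 4 * ((R : ℝ) + 2) * s ≤ δ)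
    {x y : Fin 4 → ℤ} (hx : ‖s • siteToE x‖ ≤ σ') (hy : ‖s • siteToE y‖ ≤ σ')
    (hxy : δ ≤ ‖s • siteToE x - s • siteToE y‖) :
    ∃ k : Fin 4, (2 * (R : ℤ) + 4) ≤ |((((x k - y k : ℤ) : ZMod (2 * L + 1))).valMinAbs : ℤ)| := by
  obtain ⟨k, hk⟩ := exists_norm_le_two_mul_abs_apply (s • siteToE x - s • siteToE y)
  refine ⟨k, ?_⟩
  have hcoord : (s • siteToE x - s • siteToE y) k = s * ((x k : ℝ) - (y k : ℝ)) := by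
    simp [siteToE_apply, mul_sub]
  rw [hcoord, abs_mul, abs_of_pos hs] at hk
  -- no wrap-around: `|x k - y k| ≤ L`
  have hxk : |s * (x k : ℝ)| ≤ σ' := by
    have h := PiLp.norm_apply_le (s • siteToE x) k
    rw [Real.norm_eq_abs] at h
    have e : (s • siteToE x) k = s * (x k : ℝ) := by simp [siteToE_apply]
    rw [e] at h
    exact h.trans hx
  have hyk : |s * (y k : ℝ)| ≤ σ' := by
    have h := PiLp.norm_apply_le (s • siteToE y) k
    rw [Real.norm_eq_abs] at h
    have e : (s • siteToE y) k = s * (y k : ℝ) := by simp [siteToE_apply]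
    rw [e] at h
    exact h.trans hy
  have habs : |x k - y k| ≤ (L : ℤ) := by
    have h1 : s * |((x k - y k : ℤ) : ℝ)| ≤ s * L := by
      push_cast
      rw [← abs_of_pos hs, ← abs_mul, mul_sub, abs_of_pos hs]
      calc |s * (x k : ℝ) - s * (y k : ℝ)| ≤ |s * (x k : ℝ)| + |s * (y k : ℝ)| := abs_sub _ _
        _ ≤ σ' + σ' := add_le_add hxk hyk
        _ ≤ s * L := by linarith
    exact_mod_cast le_of_mul_le_mul_left h1 hs
  rw [Summit.QuantumFields.YangMills.Theorems.OSLegsFromFemtoAndGap.valMinAbs_intCast_of_abs_le habs]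
  -- `δ ≤ 2 s |x k - y k|` and `4(R+2)s ≤ δ`
  have h2 : ((2 * (R : ℤ) + 4 : ℤ) : ℝ) * s ≤ s * |((x k - y k : ℤ) : ℝ)| := by
    push_cast
    nlinarith [abs_nonneg ((x k : ℝ) - (y k : ℝ))]
  have h3 : ((2 * (R : ℤ) + 4 : ℤ) : ℝ) ≤ |((x k - y k : ℤ) : ℝ)| := by
    rw [mul_comm] at h2
    exact le_of_mul_le_mul_left h2 hs
  have h4 : ((2 * (R : ℤ) + 4 : ℤ) : ℝ) ≤ ((|x k - y k| : ℤ) : ℝ) := by push_cast; push_cast at h3; exact h3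
  exact_mod_cast h4

/-! ## §2 Lattice `ℓ¹` sums of dilates of a compactly supported witness, and of their differences -/

section Sums

variable {v : 𝓢(EuclideanSpace ℝ (Fin 4), ℝ)} {M σ : ℝ}

/-- **Sum of a dilate**: `Σ_{x∈Λ} |v((μ s)·x)| ≤ M (2σ+3)⁴ / (μ s)⁴` for `|v| ≤ M`, `tsupport v ⊆ B̄(0, σ)`, `0 < μ s ≤ 1`. [folklore] -/
theorem sum_abs_dilate_le (hM : ∀ y : EuclideanSpace ℝ (Fin 4), |v y| ≤ M)
    (hvσ : tsupport (v : EuclideanSpace ℝ (Fin 4) → ℝ) ⊆ Metric.closedBall 0 σ) (hσ : 0 ≤ σ) {μ s : ℝ}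
    (hμs : 0 < μ * s) (hμs1 : μ * s ≤ 1) (Λ : Finset (Fin 4 → ℤ)) :
    ∑ x ∈ Λ, |v ((μ * s) • siteToE x)| ≤ M * (2 * σ + 3) ^ 4 / (μ * s) ^ 4 :=
  sum_abs_lattice_le_sup_div hM hvσ hσ hμs hμs1 Λ

/-- **Sum of a reflected dilate**: the same bound for `Σ_{x∈Λ} |v(θ((μ s)·x))|`. [folklore] -/
theorem sum_abs_theta_dilate_le (hM : ∀ y : EuclideanSpace ℝ (Fin 4), |v y| ≤ M)
    (hvσ : tsupport (v : EuclideanSpace ℝ (Fin 4) → ℝ) ⊆ Metric.closedBall 0 σ) (hσ : 0 ≤ σ) {μ s : ℝ}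
    (hμs : 0 < μ * s) (hμs1 : μ * s ≤ 1) (Λ : Finset (Fin 4 → ℤ)) :
    ∑ x ∈ Λ, |thetaTest 4 v ((μ * s) • siteToE x)| ≤ M * (2 * σ + 3) ^ 4 / (μ * s) ^ 4 :=
  sum_abs_lattice_le_sup_div (v := thetaTest 4 v) (fun y => by rw [thetaTest_apply]; exact hM _)
    (tsupport_thetaTest_subset_closedBall_zero hvσ) hσ hμs hμs1 Λ

variable (D₁ D₂ : EuclideanSpace ℝ (Fin 4) ≃L[ℝ] EuclideanSpace ℝ (Fin 4)) (μ ν : ℝ)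
  (hD₁ : ∀ x, D₁ x = μ • x) (hD₂ : ∀ x, D₂ x = ν • x)
include hD₁ hD₂

/-- The difference of two dilates of `v` (as a Schwartz map) is supported in the ball of radius `σ/m₁` and bounded by
`Lip · (σ/m₁) · |μ − ν|`. [folklore] -/
theorem dilate_sub_dilate_bounds {Lip : ℝ} (hLip0 : 0 ≤ Lip)
    (hLip : ∀ x y : EuclideanSpace ℝ (Fin 4), |v x - v y| ≤ Lip * ‖x - y‖) (hσ : 0 ≤ σ)
    (hvσ : tsupport (v : EuclideanSpace ℝ (Fin 4) → ℝ) ⊆ Metric.closedBall 0 σ) {m₁ : ℝ} (hm₁ : 0 < m₁)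
    (hμ : m₁ ≤ μ) (hν : m₁ ≤ ν) :
    (∀ y : EuclideanSpace ℝ (Fin 4),
        |(SchwartzMap.compCLMOfContinuousLinearEquiv ℝ D₁ v - SchwartzMap.compCLMOfContinuousLinearEquiv ℝ D₂ v) y| ≤
          Lip * (σ / m₁) * |μ - ν|) ∧
      tsupport ((SchwartzMap.compCLMOfContinuousLinearEquiv ℝ D₁ v -
          SchwartzMap.compCLMOfContinuousLinearEquiv ℝ D₂ v : 𝓢(EuclideanSpace ℝ (Fin 4), ℝ)) :
            EuclideanSpace ℝ (Fin 4) → ℝ) ⊆ Metric.closedBall 0 (σ / m₁) := by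
  have happly : ∀ y : EuclideanSpace ℝ (Fin 4),
      (SchwartzMap.compCLMOfContinuousLinearEquiv ℝ D₁ v - SchwartzMap.compCLMOfContinuousLinearEquiv ℝ D₂ v) y =
        v (μ • y) - v (ν • y) := by
    intro y
    rw [sub_apply, SchwartzMap.compCLMOfContinuousLinearEquiv_apply,
      SchwartzMap.compCLMOfContinuousLinearEquiv_apply, Function.comp_apply, Function.comp_apply, hD₁, hD₂]
  refine ⟨fun y => by rw [happly]; exact abs_dilate_sub_dilate_le hLip0 hLip hσ hvσ hm₁ hμ hν y, ?_⟩
  -- outside the ball both dilates vanish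
  have hball : ∀ {ρ : ℝ}, m₁ ≤ ρ → ∀ {y : EuclideanSpace ℝ (Fin 4)}, v (ρ • y) ≠ 0 → ‖y‖ ≤ σ / m₁ := by
    intro ρ hρ y hne
    have hmem := hvσ (subset_tsupport _ (Function.mem_support.2 hne))
    rw [Metric.mem_closedBall, dist_zero_right, norm_smul, Real.norm_of_nonneg (hm₁.le.trans hρ)] at hmem
    rw [le_div_iff₀ hm₁]
    calc ‖y‖ * m₁ ≤ ‖y‖ * ρ := mul_le_mul_of_nonneg_left hρ (norm_nonneg _)
      _ = ρ * ‖y‖ := mul_comm _ _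
      _ ≤ σ := hmem
  have hsupp : Function.support ((SchwartzMap.compCLMOfContinuousLinearEquiv ℝ D₁ v -
      SchwartzMap.compCLMOfContinuousLinearEquiv ℝ D₂ v : 𝓢(EuclideanSpace ℝ (Fin 4), ℝ)) :
        EuclideanSpace ℝ (Fin 4) → ℝ) ⊆ Metric.closedBall 0 (σ / m₁) := by
    intro y hy
    rw [Function.mem_support] at hy
    have hy' : v (μ • y) - v (ν • y) ≠ 0 := by rwa [happly] at hy
    rw [Metric.mem_closedBall, dist_zero_right]
    by_cases h1 : v (μ • y) = 0
    · have h2 : v (ν • y) ≠ 0 := by intro h2; exact hy' (by rw [h1, h2, sub_zero])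
      exact hball hν h2
    · exact hball hμ h1
  exact closure_minimal hsupp Metric.isClosed_closedBall

/-- **Sum of the difference of two dilates**: `Σ_{x∈Λ} |v((μ s)·x) − v((ν s)·x)| ≤ Lip (σ/m₁) |μ−ν| (2σ/m₁ + 3)⁴ / s⁴`
(`0 < s ≤ 1`, `μ, ν ≥ m₁ > 0`). [folklore] -/
theorem sum_abs_dilate_sub_le {Lip : ℝ} (hLip0 : 0 ≤ Lip)
    (hLip : ∀ x y : EuclideanSpace ℝ (Fin 4), |v x - v y| ≤ Lip * ‖x - y‖) (hσ : 0 ≤ σ)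
    (hvσ : tsupport (v : EuclideanSpace ℝ (Fin 4) → ℝ) ⊆ Metric.closedBall 0 σ) {m₁ : ℝ} (hm₁ : 0 < m₁)
    (hμ : m₁ ≤ μ) (hν : m₁ ≤ ν) {s : ℝ} (hs : 0 < s) (hs1 : s ≤ 1) (Λ : Finset (Fin 4 → ℤ)) :
    ∑ x ∈ Λ, |v ((μ * s) • siteToE x) - v ((ν * s) • siteToE x)| ≤
      Lip * (σ / m₁) * |μ - ν| * (2 * (σ / m₁) + 3) ^ 4 / s ^ 4 := by
  obtain ⟨hsup, hts⟩ := dilate_sub_dilate_bounds D₁ D₂ μ ν hD₁ hD₂ hLip0 hLip hσ hvσ hm₁ hμ hν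
  have h := sum_abs_lattice_le_sup_div hsup hts (div_nonneg hσ hm₁.le) hs hs1 Λ
  refine le_trans (le_of_eq (Finset.sum_congr rfl fun x _ => ?_)) h
  congr 1
  rw [sub_apply, SchwartzMap.compCLMOfContinuousLinearEquiv_apply,
    SchwartzMap.compCLMOfContinuousLinearEquiv_apply, Function.comp_apply, Function.comp_apply, hD₁, hD₂,
    smul_smul, smul_smul]

/-- **Sum of the difference of two reflected dilates** (same bound). [folklore] -/
theorem sum_abs_theta_dilate_sub_le {Lip : ℝ} (hLip0 : 0 ≤ Lip)
    (hLip : ∀ x y : EuclideanSpace ℝ (Fin 4), |v x - v y| ≤ Lip * ‖x - y‖) (hσ : 0 ≤ σ)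
    (hvσ : tsupport (v : EuclideanSpace ℝ (Fin 4) → ℝ) ⊆ Metric.closedBall 0 σ) {m₁ : ℝ} (hm₁ : 0 < m₁)
    (hμ : m₁ ≤ μ) (hν : m₁ ≤ ν) {s : ℝ} (hs : 0 < s) (hs1 : s ≤ 1) (Λ : Finset (Fin 4 → ℤ)) :
    ∑ x ∈ Λ, |thetaTest 4 v ((μ * s) • siteToE x) - thetaTest 4 v ((ν * s) • siteToE x)| ≤
      Lip * (σ / m₁) * |μ - ν| * (2 * (σ / m₁) + 3) ^ 4 / s ^ 4 := by
  obtain ⟨hsup, hts⟩ := dilate_sub_dilate_bounds D₁ D₂ μ ν hD₁ hD₂ hLip0 hLip hσ hvσ hm₁ hμ hν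
  have h := sum_abs_lattice_le_sup_div
    (v := thetaTest 4 (SchwartzMap.compCLMOfContinuousLinearEquiv ℝ D₁ v - SchwartzMap.compCLMOfContinuousLinearEquiv ℝ D₂ v))
    (fun y => by rw [thetaTest_apply]; exact hsup _) (tsupport_thetaTest_subset_closedBall_zero hts)
    (div_nonneg hσ hm₁.le) hs hs1 Λ
  refine le_trans (le_of_eq (Finset.sum_congr rfl fun x _ => ?_)) h
  congr 1
  rw [thetaTest_apply, thetaTest_apply, thetaTest_apply, sub_apply,
    SchwartzMap.compCLMOfContinuousLinearEquiv_apply, SchwartzMap.compCLMOfContinuousLinearEquiv_apply,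
    Function.comp_apply, Function.comp_apply, hD₁, hD₂, (timeReflection 4).map_smul, (timeReflection 4).map_smul,
    (timeReflection 4).map_smul, smul_smul, smul_smul]

end Sums

/-! ## §3 Smeared three-point sums: differences inherit pointwise bounds on the charged triples -/

section Smeared

variable (G : Type) [Group G] [TopologicalSpace G] [IsTopologicalGroup G] [CompactSpace G]
  [MeasurableSpace G] [BorelSpace G] (r : LatticeRep G)

/-- Triple products of sums are triple sums of products. [folklore] -/
theorem triple_prod_eq_sum {ι : Type*} (s t u : Finset ι) (a b c : ι → ℝ) :
    (∑ x ∈ s, a x) * (∑ y ∈ t, b y) * (∑ z ∈ u, c z) = ∑ x ∈ s, ∑ y ∈ t, ∑ z ∈ u, a x * b y * c z := by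
  rw [Finset.sum_mul_sum, Finset.sum_mul]
  refine Finset.sum_congr rfl fun x _ => ?_
  rw [Finset.sum_mul]
  refine Finset.sum_congr rfl fun y _ => ?_
  rw [Finset.mul_sum]

/-- **`|Q3(f₁,g₁,h₁) − Q3(f₂,g₂,h₂)| ≤ B·(S(f₁−f₂)S(g₁)S(h₁) + S(f₂)S(g₁−g₂)S(h₁) + S(f₂)S(g₂)S(h₁−h₂))`** whenever the torus
third cumulant is bounded by `B` on every triple of lattice points charged by (`f₁` or `f₂`), (`g₁` or `g₂`), (`h₁` or `h₂`)
(trilinearity; `S(w) = Σ_{x∈box L} |w(s x)|`, differences pointwise). [folklore] -/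
theorem abs_Q3_sub_Q3_le (β : ℝ) (L : ℕ) (s : ℝ) (f₁ f₂ g₁ g₂ h₁ h₂ : 𝓢(EuclideanSpace ℝ (Fin 4), ℝ)) {B : ℝ}
    (hB : ∀ x ∈ box 4 L, ∀ y ∈ box 4 L, ∀ z ∈ box 4 L, (f₁ (s • siteToE x) ≠ 0 ∨ f₂ (s • siteToE x) ≠ 0) →
      (g₁ (s • siteToE y) ≠ 0 ∨ g₂ (s • siteToE y) ≠ 0) → (h₁ (s • siteToE z) ≠ 0 ∨ h₂ (s • siteToE z) ≠ 0) →
      |torusK3 G r β L x y z| ≤ B) :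
    |Q3 G r β L s f₁ g₁ h₁ - Q3 G r β L s f₂ g₂ h₂| ≤
      B * ((∑ x ∈ box 4 L, |f₁ (s • siteToE x) - f₂ (s • siteToE x)|) * (∑ y ∈ box 4 L, |g₁ (s • siteToE y)|) *
            (∑ z ∈ box 4 L, |h₁ (s • siteToE z)|) +
        (∑ x ∈ box 4 L, |f₂ (s • siteToE x)|) * (∑ y ∈ box 4 L, |g₁ (s • siteToE y) - g₂ (s • siteToE y)|) *
            (∑ z ∈ box 4 L, |h₁ (s • siteToE z)|) +
        (∑ x ∈ box 4 L, |f₂ (s • siteToE x)|) * (∑ y ∈ box 4 L, |g₂ (s • siteToE y)|) *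
            (∑ z ∈ box 4 L, |h₁ (s • siteToE z) - h₂ (s • siteToE z)|)) := by
  -- shorthand
  set K : (Fin 4 → ℤ) → (Fin 4 → ℤ) → (Fin 4 → ℤ) → ℝ := fun x y z => torusK3 G r β L x y z with hK
  set F₁ : (Fin 4 → ℤ) → ℝ := fun x => f₁ (s • siteToE x)
  set F₂ : (Fin 4 → ℤ) → ℝ := fun x => f₂ (s • siteToE x)
  set G₁ : (Fin 4 → ℤ) → ℝ := fun y => g₁ (s • siteToE y)
  set G₂ : (Fin 4 → ℤ) → ℝ := fun y => g₂ (s • siteToE y)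
  set H₁ : (Fin 4 → ℤ) → ℝ := fun z => h₁ (s • siteToE z)
  set H₂ : (Fin 4 → ℤ) → ℝ := fun z => h₂ (s • siteToE z)
  have hQ : ∀ f g h : 𝓢(EuclideanSpace ℝ (Fin 4), ℝ), Q3 G r β L s f g h =
      ∑ x ∈ box 4 L, ∑ y ∈ box 4 L, ∑ z ∈ box 4 L,
        f (s • siteToE x) * g (s • siteToE y) * h (s • siteToE z) * K x y z := by
    intro f g h; rfl
  -- termwise bound
  have hterm : ∀ x ∈ box 4 L, ∀ y ∈ box 4 L, ∀ z ∈ box 4 L,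
      |F₁ x * G₁ y * H₁ z * K x y z - F₂ x * G₂ y * H₂ z * K x y z| ≤
        (|F₁ x - F₂ x| * |G₁ y| * |H₁ z| + |F₂ x| * |G₁ y - G₂ y| * |H₁ z| + |F₂ x| * |G₂ y| * |H₁ z - H₂ z|) * B := by
    intro x hx y hy z hz
    have e : F₁ x * G₁ y * H₁ z * K x y z - F₂ x * G₂ y * H₂ z * K x y z =
        ((F₁ x - F₂ x) * G₁ y * H₁ z + F₂ x * (G₁ y - G₂ y) * H₁ z + F₂ x * G₂ y * (H₁ z - H₂ z)) * K x y z := by ring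
    rw [e, abs_mul]
    by_cases hc : (F₁ x ≠ 0 ∨ F₂ x ≠ 0) ∧ (G₁ y ≠ 0 ∨ G₂ y ≠ 0) ∧ (H₁ z ≠ 0 ∨ H₂ z ≠ 0)
    · have hKB : |K x y z| ≤ B := hB x hx y hy z hz hc.1 hc.2.1 hc.2.2
      have hcoef : |(F₁ x - F₂ x) * G₁ y * H₁ z + F₂ x * (G₁ y - G₂ y) * H₁ z + F₂ x * G₂ y * (H₁ z - H₂ z)| ≤
          |F₁ x - F₂ x| * |G₁ y| * |H₁ z| + |F₂ x| * |G₁ y - G₂ y| * |H₁ z| + |F₂ x| * |G₂ y| * |H₁ z - H₂ z| := by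
        refine (abs_add_le _ _).trans (add_le_add ((abs_add_le _ _).trans (add_le_add ?_ ?_)) ?_)
        · rw [abs_mul, abs_mul]
        · rw [abs_mul, abs_mul]
        · rw [abs_mul, abs_mul]
      exact mul_le_mul hcoef hKB (abs_nonneg _) (by positivity)
    · -- an uncharged triple: both sides vanish
      simp only [not_and_or, not_or, not_not] at hc
      rcases hc with ⟨h1, h2⟩ | ⟨h1, h2⟩ | ⟨h1, h2⟩
      · simp [h1, h2]
      · simp [h1, h2]
      · simp [h1, h2]
  rw [hQ, hQ, ← Finset.sum_sub_distrib]
  calc |∑ x ∈ box 4 L, (∑ y ∈ box 4 L, ∑ z ∈ box 4 L, F₁ x * G₁ y * H₁ z * K x y z -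
          ∑ y ∈ box 4 L, ∑ z ∈ box 4 L, F₂ x * G₂ y * H₂ z * K x y z)|
      ≤ ∑ x ∈ box 4 L, ∑ y ∈ box 4 L, ∑ z ∈ box 4 L,
          (|F₁ x - F₂ x| * |G₁ y| * |H₁ z| + |F₂ x| * |G₁ y - G₂ y| * |H₁ z| + |F₂ x| * |G₂ y| * |H₁ z - H₂ z|) * B := by
        refine (Finset.abs_sum_le_sum_abs _ _).trans (Finset.sum_le_sum fun x hx => ?_)
        rw [← Finset.sum_sub_distrib]
        refine (Finset.abs_sum_le_sum_abs _ _).trans (Finset.sum_le_sum fun y hy => ?_)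
        rw [← Finset.sum_sub_distrib]
        exact (Finset.abs_sum_le_sum_abs _ _).trans (Finset.sum_le_sum fun z hz => hterm x hx y hy z hz)
    _ = B * ((∑ x ∈ box 4 L, |F₁ x - F₂ x|) * (∑ y ∈ box 4 L, |G₁ y|) * (∑ z ∈ box 4 L, |H₁ z|) +
          (∑ x ∈ box 4 L, |F₂ x|) * (∑ y ∈ box 4 L, |G₁ y - G₂ y|) * (∑ z ∈ box 4 L, |H₁ z|) +
          (∑ x ∈ box 4 L, |F₂ x|) * (∑ y ∈ box 4 L, |G₂ y|) * (∑ z ∈ box 4 L, |H₁ z - H₂ z|)) := by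
        rw [triple_prod_eq_sum, triple_prod_eq_sum, triple_prod_eq_sum, ← Finset.sum_add_distrib,
          ← Finset.sum_add_distrib, Finset.mul_sum]
        refine Finset.sum_congr rfl fun x _ => ?_
        rw [← Finset.sum_add_distrib, ← Finset.sum_add_distrib, Finset.mul_sum]
        refine Finset.sum_congr rfl fun y _ => ?_
        rw [← Finset.sum_add_distrib, ← Finset.sum_add_distrib, Finset.mul_sum]
        refine Finset.sum_congr rfl fun z _ => ?_
        ring

end Smeared

end Summit.QuantumFields.YangMills.Cruxes.NT.Subsequential

end
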